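import Summits.CriticalPhenomena.PercolationContinuityZ3.Theorems.PercNearOneGluingNoHeavyLowerTailTwoCopyAtomicBridge
import Summits.CriticalPhenomena.PercolationContinuityZ3.Theorems.PercNearOneGluingNoHeavyLowerTailNineTypeCellCount

/-!
# Reachability after attaching a fresh vertex by a star (peeling lemma for the vertex-cover bridge)

Support file for crux `stmt-CriticalPhenomena-4575`, seat `prim-bnk-1` gen 38; memo
`run/shared/lean/prim/prim-l12/FROM-prim-bnk-1-gen38-VC-CLASS-THEOREM.md` §6 (bridge step (b)).

If the vertex `h` meets no pair of the configuration `ω`, then after adding the star `{s(h,x) : x ∈ X}` two vertices `p, q ≠ h`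
are joined by an open path iff they were joined in `ω`, or `p` is joined in `ω` to some `x ∈ X` and some `x' ∈ X` is joined in `ω`
to `q` (`reachable_union_star_iff`).  This is the connectivity content of the GADGET FACTORISATION used by the vertex-cover-class
certificates (`VCCone.vcWord_botbot_nonneg_*`, `…Q44VertexCoverConeW`): attaching a hub whose edges go to terminals only changes
the terminal profile by a join with the block of its attached terminals, independently of the rest of the graph.
No sorries, no named facts, no definitions; standard axioms.
-/

namespace Summit.CriticalPhenomena.PercolationContinuityZ3.Theorems

open Set Finset Literature.Probability.Percolation

namespace VCCone

variable {n : ℕ}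

/-- The star of `h` over the finite vertex set `X`, as a configuration. [this work] -/
theorem mem_image_star {h : Fin n} {X : Finset (Fin n)} {e : Sym2 (Fin n)} :
    e ∈ ((X.image fun x => s(h, x)) : Set (Sym2 (Fin n))) ↔ ∃ x ∈ X, e = s(h, x) := by
  simp only [Finset.coe_image, Set.mem_image, Finset.mem_coe]
  constructor
  · rintro ⟨x, hx, rfl⟩; exact ⟨x, hx, rfl⟩
  · rintro ⟨x, hx, rfl⟩; exact ⟨x, hx, rfl⟩

/-- **Reachability after attaching a fresh vertex by a star.**  Let `h` meet no pair of `ω` and `h ∉ X`.  For `p, q ≠ h`: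
`p ↔ q` in `ω ∪ {s(h,x) : x ∈ X}` iff `p ↔ q` in `ω`, or `p ↔ x` and `x' ↔ q` in `ω` for some `x, x' ∈ X`. [this work] -/
theorem reachable_union_star_iff (ω : Set (Sym2 (Fin n))) (h : Fin n) (hfresh : ∀ e ∈ ω, h ∉ e)
    (X : Finset (Fin n)) (hX : h ∉ X) {p q : Fin n} (hp : p ≠ h) (hq : q ≠ h) :
    (openGraph (ω ∪ ((X.image fun x => s(h, x)) : Set (Sym2 (Fin n))))).Reachable p q ↔
      (openGraph ω).Reachable p q ∨
        ∃ x ∈ X, ∃ x' ∈ X, (openGraph ω).Reachable p x ∧ (openGraph ω).Reachable x' q := by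
  classical
  -- `h` is isolated in `ω`
  have hiso : ∀ {p : Fin n}, p ≠ h → ((openGraph ω).Reachable p h ↔ False) := by
    intro p hp
    refine ⟨fun hr => ?_, False.elim⟩
    rw [SimpleGraph.reachable_iff_reflTransGen] at hr
    rcases Relation.ReflTransGen.cases_tail hr with heq | ⟨m, _, hadj⟩
    · exact hp heq.symm
    · rw [openGraph_adj] at hadj
      exact hfresh _ hadj.1 (Sym2.mem_iff.2 (Or.inr rfl))
  -- induction on X, generalising p q
  induction X using Finset.induction_on generalizing p q with
  | empty =>
    simp only [Finset.image_empty, Finset.coe_empty, Set.union_empty, Finset.notMem_empty, false_and, exists_false,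
      or_false]
  | insert x₀ X hx₀ ih =>
    have hx₀h : x₀ ≠ h := fun e => hX (e ▸ Finset.mem_insert_self _ _)
    have hX' : h ∉ X := fun e => hX (Finset.mem_insert_of_mem e)
    -- the configuration with the new pair singled out
    have hset : (ω ∪ (((insert x₀ X).image fun x => s(h, x)) : Set (Sym2 (Fin n)))) =
        insert s(h, x₀) (ω ∪ ((X.image fun x => s(h, x)) : Set (Sym2 (Fin n)))) := by
      ext e
      simp only [Set.mem_union, mem_image_star, Finset.mem_insert, Set.mem_insert_iff]
      constructor
      · rintro (he | ⟨x, hx | hx, rfl⟩)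
        · exact Or.inr (Or.inl he)
        · exact Or.inl (by rw [hx])
        · exact Or.inr (Or.inr ⟨x, hx, rfl⟩)
      · rintro (he | he | ⟨x, hx, rfl⟩)
        · exact Or.inr ⟨x₀, Or.inl rfl, he⟩
        · exact Or.inl he
        · exact Or.inr ⟨x, Or.inr hx, rfl⟩
    set ω' := ω ∪ ((X.image fun x => s(h, x)) : Set (Sym2 (Fin n))) with hω'
    -- reachability of `h` itself in `ω'`: exactly through `X`
    have reachH : ∀ {p : Fin n}, p ≠ h → ((openGraph ω').Reachable p h ↔ ∃ x ∈ X, (openGraph ω).Reachable p x) := by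
      intro p hp
      constructor
      · intro hr
        rw [SimpleGraph.reachable_iff_reflTransGen] at hr
        rcases Relation.ReflTransGen.cases_tail hr with heq | ⟨m, hpm, hadj⟩
        · exact absurd heq.symm hp
        · rw [openGraph_adj] at hadj
          obtain ⟨hmem, hmh⟩ := hadj
          rcases (Set.mem_union _ _ _).1 hmem with hω | hstar
          · exact absurd (Sym2.mem_iff.2 (Or.inr rfl)) (hfresh _ hω)
          · obtain ⟨x, hx, hxe⟩ := mem_image_star.1 hstar
            have hmx : m = x := by
              rcases Sym2.eq_iff.1 hxe with ⟨hm, _⟩ | ⟨hm, _⟩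
              · exact absurd hm hmh
              · exact hm
            subst hmx
            have hpm' : (openGraph ω').Reachable p m := (SimpleGraph.reachable_iff_reflTransGen _ _).2 hpm
            rcases (ih hX' hp hmh).1 hpm' with h1 | ⟨x, hxX, x', _, h1, _⟩
            · exact ⟨m, hx, h1⟩
            · exact ⟨x, hxX, h1⟩
      · rintro ⟨x, hx, hpx⟩
        have hxh : x ≠ h := fun e => hX' (e ▸ hx)
        have h1 : (openGraph ω').Reachable p x :=
          (ih hX' hp hxh).2 (Or.inl hpx)
        have h2 : (openGraph ω').Adj x h := by
          rw [openGraph_adj]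
          refine ⟨Set.mem_union_right _ (mem_image_star.2 ⟨x, hx, Sym2.eq_swap⟩), hxh⟩
        exact h1.trans h2.reachable
    rw [hset, TwoCopyMono.reachable_insert_iff']
    -- now a case analysis
    constructor
    · rintro (h1 | ⟨h2, h3⟩ | ⟨h4, h5⟩)
      · rcases (ih hX' hp hq).1 h1 with h | ⟨x, hx, x', hx', hpx, hxq⟩
        · exact Or.inl h
        · exact Or.inr ⟨x, Finset.mem_insert_of_mem hx, x', Finset.mem_insert_of_mem hx', hpx, hxq⟩
      · -- p ↔ h and x₀ ↔ q in ω'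
        obtain ⟨x, hx, hpx⟩ := (reachH hp).1 h2
        rcases (ih hX' hx₀h hq).1 h3 with h | ⟨x1, _, x', hx', _, hxq⟩
        · exact Or.inr ⟨x, Finset.mem_insert_of_mem hx, x₀, Finset.mem_insert_self _ _, hpx, h⟩
        · exact Or.inr ⟨x, Finset.mem_insert_of_mem hx, x', Finset.mem_insert_of_mem hx', hpx, hxq⟩
      · -- p ↔ x₀ and h ↔ q in ω'
        obtain ⟨x', hx', hqx⟩ := (reachH hq).1 h5.symm
        rcases (ih hX' hp hx₀h).1 h4 with h | ⟨x, hx, x1, _, hpx, _⟩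
        · exact Or.inr ⟨x₀, Finset.mem_insert_self _ _, x', Finset.mem_insert_of_mem hx', h, hqx.symm⟩
        · exact Or.inr ⟨x, Finset.mem_insert_of_mem hx, x', Finset.mem_insert_of_mem hx', hpx, hqx.symm⟩
    · rintro (h | ⟨x, hx, x', hx', hpx, hxq⟩)
      · exact Or.inl ((ih hX' hp hq).2 (Or.inl h))
      · rcases Finset.mem_insert.1 hx with hxe | hxX
        · rcases Finset.mem_insert.1 hx' with hxe' | hxX'
          · -- both are x₀: p ↔ x₀ ↔ q already in ω
            rw [hxe] at hpx; rw [hxe'] at hxq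
            exact Or.inl ((ih hX' hp hq).2 (Or.inl (hpx.trans hxq)))
          · -- p ↔ x₀, and h ↔ q via x'
            rw [hxe] at hpx
            refine Or.inr (Or.inr ⟨(ih hX' hp hx₀h).2 (Or.inl hpx), ?_⟩)
            exact ((reachH hq).2 ⟨x', hxX', hxq.symm⟩).symm
        · rcases Finset.mem_insert.1 hx' with hxe' | hxX'
          · -- p ↔ h via x, and x₀ ↔ q
            rw [hxe'] at hxq
            exact Or.inr (Or.inl ⟨(reachH hp).2 ⟨x, hxX, hpx⟩, (ih hX' hx₀h hq).2 (Or.inl hxq)⟩)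
          · exact Or.inl ((ih hX' hp hq).2 (Or.inr ⟨x, hxX, x', hxX', hpx, hxq⟩))

/-! ## The terminal profile after attaching a hub -/

open TwoCopyMono FourPointAtoms

/-- **Profile form.**  Attaching the fresh vertex `h` to the terminals with indices in `KX`: `qᵢ ↔ qⱼ` afterwards iff `qᵢ ↔ qⱼ`
before, or `qᵢ ↔ q_k` and `q_{k'} ↔ qⱼ` before for some `k, k' ∈ KX`. [this work] -/
theorem prof_union_star_iff (a b c y : Fin n) (ω : Set (Sym2 (Fin n))) (h : Fin n) (hfresh : ∀ e ∈ ω, h ∉ e)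
    (KX : Finset (Fin 4)) (hh : ∀ k : Fin 4, quad a b c y k ≠ h) (i j : Fin 4) :
    prof a b c y (ω ∪ ((KX.image fun k => s(h, quad a b c y k)) : Set (Sym2 (Fin n)))) i j = true ↔
      prof a b c y ω i j = true ∨
        ∃ k ∈ KX, ∃ k' ∈ KX, prof a b c y ω i k = true ∧ prof a b c y ω k' j = true := by
  classical
  have himg : (KX.image fun k => s(h, quad a b c y k)) = (KX.image (quad a b c y)).image fun x => s(h, x) := by
    rw [Finset.image_image]; rfl
  have hX : h ∉ KX.image (quad a b c y) := by
    rw [Finset.mem_image]; rintro ⟨k, _, hk⟩; exact hh k hk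
  rw [himg, prof_true_iff, reachable_union_star_iff ω h hfresh _ hX (hh i) (hh j), prof_true_iff]
  simp only [prof_true_iff, Finset.mem_image]
  constructor
  · rintro (h1 | ⟨x, ⟨k, hk, rfl⟩, x', ⟨k', hk', rfl⟩, h1, h2⟩)
    · exact Or.inl h1
    · exact Or.inr ⟨k, hk, k', hk', h1, h2⟩
  · rintro (h1 | ⟨k, hk, k', hk', h1, h2⟩)
    · exact Or.inl h1
    · exact Or.inr ⟨quad a b c y k, ⟨k, hk, rfl⟩, quad a b c y k', ⟨k', hk', rfl⟩, h1, h2⟩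

/-- **Cell form (the gadget factorisation step).**  If the terminal cell of `ω` is `ci`, `g` is the cell gluing exactly the
terminals with indices in `KX`, and `J` is the least upper bound of `ci` and `g` in the cell order `ple` (e.g. `VCCone.pjoin ci g`,
by `VCCone.pjoin_spec`), then the terminal cell after attaching the hub `h` to `KX` is `J`. [this work] -/
theorem prof_union_star_eq_pp (a b c y : Fin n) (ω : Set (Sym2 (Fin n))) (h : Fin n) (hfresh : ∀ e ∈ ω, h ∉ e)
    (KX : Finset (Fin 4)) (hh : ∀ k : Fin 4, quad a b c y k ≠ h) {ci g J : Fin 15} (hci : prof a b c y ω = pp ci)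
    (hg : ∀ k k' : Fin 4, pp g k k' = true ↔ (k = k' ∨ (k ∈ KX ∧ k' ∈ KX)))
    (hJ1 : ple ci J = true) (hJ2 : ple g J = true) (hJ3 : ∀ m : Fin 15, ple ci m = true → ple g m = true → ple J m = true) :
    prof a b c y (ω ∪ ((KX.image fun k => s(h, quad a b c y k)) : Set (Sym2 (Fin n)))) = pp J := by
  classical
  set N := prof a b c y (ω ∪ ((KX.image fun k => s(h, quad a b c y k)) : Set (Sym2 (Fin n)))) with hN
  obtain ⟨j, hj⟩ := exists_pat_of_isEqv (prof_isEqv a b c y (ω ∪ ((KX.image fun k => s(h, quad a b c y k)) : Set (Sym2 (Fin n)))))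
  have hiff := prof_union_star_iff a b c y ω h hfresh KX hh
  have hold : ∀ k k' : Fin 4, prof a b c y ω k k' = true ↔ pp ci k k' = true := fun k k' => by rw [hci]
  have hnew : ∀ k k' : Fin 4, N k k' = true ↔ pp j k k' = true := fun k k' => by rw [hN, hj]
  have hanti : ∀ x z : Fin 15, ple x z = true → ple z x = true → x = z := by decide
  -- `J ≤ j`
  have h1 : ple ci j = true := by
    refine ple_of_profLE ⟨fun k k' hk => ?_⟩
    exact (hnew k k').1 ((hiff k k').2 (Or.inl ((hold k k').2 hk)))
  have h2 : ple g j = true := by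
    refine ple_of_profLE ⟨fun k k' hk => ?_⟩
    rcases (hg k k').1 hk with rfl | ⟨hk1, hk2⟩
    · exact (isEqv_pp j).refl k
    · exact (hnew k k').1 ((hiff k k').2 (Or.inr ⟨k, hk1, k', hk2, (prof_isEqv a b c y ω).refl k,
        (prof_isEqv a b c y ω).refl k'⟩))
  have hJj : ple J j = true := hJ3 j h1 h2
  -- `j ≤ J`
  have hjJ : ple j J = true := by
    refine ple_of_profLE ⟨fun k k' hk => ?_⟩
    rcases (hiff k k').1 ((hnew k k').2 hk) with hkk | ⟨x, hx, x', hx', hkx, hxk⟩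
    · exact (profLE_of_ple hJ1).le k k' ((hold k k').1 hkk)
    · have e1 : pp J k x = true := (profLE_of_ple hJ1).le k x ((hold k x).1 hkx)
      have e2 : pp J x x' = true := (profLE_of_ple hJ2).le x x' ((hg x x').2 (Or.inr ⟨hx, hx'⟩))
      have e3 : pp J x' k' = true := (profLE_of_ple hJ1).le x' k' ((hold x' k').1 hxk)
      exact (isEqv_pp J).trans k x' k' ((isEqv_pp J).trans k x x' e1 e2) e3
  rw [hN, hj, hanti J j hJj hjJ]

end VCCone

end Summit.CriticalPhenomena.PercolationContinuityZ3.Theorems
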